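import Literature.NumberTheory.Rogawski1990.ArchOrbFamGExtJumpSideAssembly             -- ★ p850629∕p850677 (LH3-p02 (g3)): `exists_std_package`, `blockWeights_of_mem_splitChartPlaces`, `isCompact_map_circleDiagonal_range`; brings ★ `ArchOrbFamGExtJumpSide`
import Literature.NumberTheory.Rogawski1990.ArchChartOrbGBlockNormal                   -- ★ p850492 (F0P3-p02 (g18)): `eM_gprimeTorus_add_smul_hcNrm_eq` (`hγ`)
import Literature.NumberTheory.Rogawski1990.ArchChartOrbGBlockNormalBinders            -- ★ p850667 (F0P3-p02 (g18)): `exists_blockNormal_binders` (`hCMν`, `hintν`)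
import Literature.NumberTheory.Automorphic.ArchInnerFormSemiregularCentralizerBlockExplicit -- ★ p850499 (LH5-p02 (g3)): (M-UNFOLD) explicit edition, clauses [4]–[10]
import Literature.MeasureTheory.Group.HaarRightInvariantOfProductDecomposition         -- ★ p850728 (F0P2-p01 (g19)): `exists_isHaarMeasure_isMulRightInvariant_isInvInvariant_centralizer_arch`
import Literature.MeasureTheory.Group.InvariantQuotientBlockDescent                    -- ★ p850497 (LH3-p03 (g4)): `exists_smul_map_mk_of_block_compact` (the `hmap` of ★ p850417)
import Literature.NumberTheory.Rogawski1990.ArchChartOrbGBlockReduction                -- ★ p850417 (F0P3-p02 (g18)) (J-G′-BLOCK): `exists_block_testFunction_chartOrbG_eventuallyEq`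
import Literature.NumberTheory.Rogawski1990.ArchDescendedFunctionSmooth                -- ★ p850672 (F0P3a-p05 (g20)) (aM-SMOOTH): `exists_contDiff_descended_eq`
import Literature.NumberTheory.Automorphic.ArchBlockEmbeddingSmooth                    -- ★ (eM-SMOOTH) (F0P3a-p05 (g20)): `exists_contDiff_coe_symm_archPiEquivCM_mulSingle_relabel_endoEmb`
import Literature.NumberTheory.Rogawski1990.ArchOrbFamGExtJumpWall                     -- ★ p850367 (LH3-p02): (c-wall) `archERhoG_mul_archRG_add_smul_hcNrm_eq`, `wallFactorLimit_ne_zero_of_hcSemireg`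
import Literature.MeasureTheory.Group.OrbitalDescentNonneg                             -- ★ p850338 (LH5-p03): `exists_continuous_hasCompactSupport_integral_comp_mul_eq_one_pos`
import Literature.Analysis.Calculus.ContDiffCompactSupportCutoff                       -- ★ p840156: `exists_contDiff_hasCompactSupport_comp_eq` (ambient cut-off to compact support)
import Literature.NumberTheory.Rogawski1990.ArchInnerFormChartOrbIntegrable              -- ★ p850485 (F0P3a-p08 (g22)): `integrable_descConj_gprimeTorus_of_regG`; brings ★ SPLIT-DOCK p850470 `uniformlyProper_gprimeTorus_of_semireg_of_regular`, ★ D4b-1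
import Literature.NumberTheory.Rogawski1990.ArchCartanWallExtensionGDocks              -- ★ p850260: brings ★ `exists_nhds_hcSemireg` (the semiregular neighbourhood)
import Literature.NumberTheory.Automorphic.ArchInnerFormChartOrbitalSmooth               -- ★ p850500 (F0P3a-p05 (g20)): `contDiff_coe_gprimeTorus`
import Literature.NumberTheory.Rogawski1990.ArchOrbFamGExtBoxDescent                  -- ★ p851016 (this seat): §1 `exists_isCompact_mul_centralizer_box_hcSemireg`, (B-desc) box edition `exists_descent_box_chartOrbG`
import Literature.NumberTheory.Rogawski1990.ArchOrbFamGExtRealWallInst                -- ★ p851012 (F0P3a-p05 (g20)): `exists_realWallBox_binders` (split-chart box binders `hCM♯`, `hint♯`)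
import Literature.NumberTheory.Automorphic.ArchInnerFormSemiregularCentralizerBlockCayleyTorus  -- ★ p850682 (F0P3b-p01 (g15)): (M-UNFOLD) with [5β] [6β] [7β] `exists_continuousMulEquiv_centralizer_gprimeTorus_semireg_cayley_torus`
import Literature.NumberTheory.Automorphic.ArchInnerFormSemiregularSplitTorusStd           -- ★ p850743 (LH5-p02 (g3)) (b2): `hTAβ_package_semireg_std`
import Literature.NumberTheory.Rogawski1990.ArchChartOrbGBlockDescentsBoxes            -- ★ p850673 (LH3-p03 (g4)): `exists_hmap_hmapβ_descentConst_eq_of_clauses` ((G′-CANCEL) `K = Kβ`)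
import Literature.NumberTheory.Rogawski1990.ArchChartOrbGBlockReductionSplit          -- ★ p850444 (F0P3-p02 (g18)): `integral_descConj_eq_smul_integral_descConj_of_block` (quotient target)
import Literature.NumberTheory.Automorphic.ArchSharedRankOneDatum                      -- ★ p850571 (F0P3-p02 (g18)): `measure_boxStd_ne_zero`, `measure_boxStd_lt_top`
import Literature.MeasureTheory.Group.InvariantQuotientAbelian                         -- ★ `isInvInvariant_of_comm`
import HarnessLib

/-!
# (B-desc) TWO-CHART EDITION: ONE block function `f`, ONE cut-off `β`, ONE constant `K` for the descent identities of the genuine `G′`-family on BOTH charts at a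
# semiregular noncompact-wall point — the compact chart `S` (torus `P·diag(e^{ic_{w₀0}}, e^{ic_{w₀2}})·P⁻¹`, target `(U(J), μ₀)`) AND the Cayley chart `S ∪ {w₀}`
# (split torus element `hypBlockGL (c_{w₀0}) (c_{w₀2})`, target `(U(J) ⧸ A_J, μ₀′)`), `(μ₀, μ₀′)` the SHARED rank-one datum
# (Rogawski 1990 §4.12 Lemma 4.12.1 «ONE φ for all x near 1», §8.2 pp. 119–124; Harish-Chandra–van Dijk 1970 I §3; Shelstad 1979 §4 Lemma 4.3)

Topic `NumberTheory/Rogawski1990`; namespace `Literature.NumberTheory.Rogawski1990`.  THEOREMS ONLY (no `def`, no instance, no notation, no axiom, no named fact, no `sorry`);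
kernel lane `--kind proof --supports stmt-HodgeConjecture-24833`.  Cell `pub/hodgecm-mathlib`, crux H413 (`stmt-HodgeConjecture-24833`), F0∕P3c line LH3 (closer stub `stub_N9`),
LETTER L1 clause (I₃) — (B-desc-hyp) DESIGN POINT of F0P3a-p05 (g20) 2026-09-02 10:25Z («two `∃ f` heads proved separately CANNOT be identified afterwards; the split-side
descent must read the SAME `f`»), agreed split: (α) this two-chart edition = LH3-p04 (g4), (β) the x-ray∕box dress through the wall = F0P3a-p05 (g20); sequel of ★ p850981
`ArchOrbFamGExtNormalLineDescent` and ★ p851016 `ArchOrbFamGExtBoxDescent`; pattern of organ J ★ p850798 `ArchOrbFamGExtJumpSideGStatement` (`hβ1S`∕`hβ1B`, (G′-CANCEL)).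

THE MATHEMATICS.  At the ONE group element `γ_p = gprimeTorus α S p` (`p` semiregular on the noncompact wall `(w₀, 0, 2)`, `w₀ ∉ S` a covered split-chart place, `S` admissible)
BOTH chart tori `T_S` and `T_{S∪w₀}` lie in `M′ = Z(γ_p)` (★ `gprimeTorus_of_wall`), and the Cayley-torus (M-UNFOLD) ★ p850682 splits `M′ ≃ B′ × K` with the torus clauses of
BOTH charts: [5]+[6] `e γ_c = (diag(e^{ic_{w₀0}}, e^{ic_{w₀2}}), r(c))`, [5β]+[6β] `e γ♯_{c″} = (boost(c″_{w₀0}, c″_{w₀2}), r(c″))` with the SAME `K`-reading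
**`r(c) = γ_{S}(update c w₀ (0, c_{w₀1}, 0))`** on both charts.  Rogawski's Lemma 4.12.1 (Harish-Chandra's compactness ★ D4b-1) is applied ONCE on the union of the two compact
sets — `C″_S` for a box around `p` on the compact chart (★ p851016 §1) and `C″_♯` for a box around `hcCayPt p` on the Cayley chart (★ p851012 `exists_realWallBox_binders`) —
giving ONE cut-off `β ≥ 0` of unit `Z(γ_p)`-mass on `(C″_S ∪ C″_♯)·Z(γ_p)` (`hβ1S`, `hβ1B`), hence ONE descended function `(a′)_M^β` and ONE jointly smooth ambient reading
`f(c, X) = χ(X) · ΘM(Λ(M₀⁻¹ X M₀) · ↑↑γ_S(update c w₀ (0,c_{w₀1},0)))` (★ (aM-SMOOTH), ★ (eM-SMOOTH), clause [8], the frame matrix `M₀` of the standardisation `φ`).  ★ D4b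
`chartOrbG_eq_integral_descended_of_cutoff` on each chart and the block reductions ★ p850417 §1 (compact block torus, target `U(J)`) ∕ ★ p850444 §1 (split block torus, target
`U(J) ⧸ A_J`) then give, with the descent scalars `κ`, `κβ` of ★ (G′-CANCEL) p850673 against the SHARED `(μ₀, μ₀′)` and its identity `dt′(B′_S)·κ = dt′(B′_♯)·κβ =: K`:
  **`chartOrbG L α ν′ S a′ c = K · ∫_{U(J)} f(c, ↑↑(h · P diag(e^{ic_{w₀0}}, e^{ic_{w₀2}}) P⁻¹ · h⁻¹)) dμ₀(h)`  for `c ∈ U ∩ RegG S`**, and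
  **`chartOrbG L α ν′ (S ∪ {w₀}) a′ c″ = K · ∫_{U(J) ⧸ A_J} f(c″, ↑↑(y · hypBlockGL(c″_{w₀0}, c″_{w₀2}) · y⁻¹)) dμ₀′(ẏ)`  for `c″ ∈ U″`, `c″_{w₀0} ≠ 0`**
(`U ∋ p`, `U″ ∋ hcCayPt w₀ 0 2 p` open; off the real wall the points of `U″` are `G`-regular).  `f` is compactly supported in `X` uniformly in `c` and depends on `c` only through
`update c w₀ (0, c_{w₀1}, 0)`; ★ p851016 is the compact-chart half with its own `β`.
HONEST LABEL: HC_CM is proved only modulo the 7 printed citations (2 remaining: hLiu418 = `stmt-HodgeConjecture-24832`, h413 = `stmt-HodgeConjecture-24833`) until rung 0 closes;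
count-neutral assembly of ★ bricks; letter L1 stays a `sorry` of record until all its clauses are paid.

## References
* [Rogawski1990] J. D. Rogawski, *Automorphic Representations of Unitary Groups in Three Variables*, Ann. of Math. Stud. 123 (1990), §4.12 Lemma 4.12.1 p. 66, §8.2 pp. 119–124.
* [HarishChandra1970] Harish-Chandra (notes by G. van Dijk), *Harmonic Analysis on Reductive p-adic Groups*, LNM 162 (1970), Part I §3 Lemmas 22–23.
* [Shelstad1979] D. Shelstad, *Characters and inner forms of a quasi-split group over ℝ*, Compositio Math. 39 (1979), §4 pp. 22–25.
* [Varadarajan1977] V. S. Varadarajan, *Harmonic Analysis on Real Reductive Groups*, LNM 576 (1977), Part I §1.12.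
-/

set_option autoImplicit false

noncomputable section

open MeasureTheory MeasureTheory.Measure NumberField NumberField.InfinitePlace NumberField.mixedEmbedding Matrix Complex Set Filter Topology
open scoped MatrixGroups Matrix Real Classical ENNReal NNReal ContDiff Matrix.Norms.Operator Pointwise
open Literature.NumberTheory.Automorphic Literature.NumberTheory.Automorphic.UnitaryGroup Literature.NumberTheory.Automorphic.ArchCartan
open Literature.NumberTheory.GaloisRepresentations Literature.MeasureTheory.Group

namespace Literature.NumberTheory.Rogawski1990

/-! ## §1 Harish-Chandra's compactness on a BOX around the semiregular point (the box twin of ★ p850667 §1) -/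

/-! ## §2 The descent identity on the box, with a jointly smooth family of block test functions -/

section Chart

variable (L : Type) [Field L] [NumberField L] [IsCMField L] (α : Fin 3 → L)
  [MeasurableSpace ↥(arch (↥(maximalRealSubfield L)) L (IsCMField.complexConj L) 3 (Matrix.diagonal α))]
  [BorelSpace ↥(arch (↥(maximalRealSubfield L)) L (IsCMField.complexConj L) 3 (Matrix.diagonal α))]
  (ν' : Measure ↥(arch (↥(maximalRealSubfield L)) L (IsCMField.complexConj L) 3 (Matrix.diagonal α))) [ν'.IsHaarMeasure] [ν'.IsMulRightInvariant]

set_option maxHeartbeats 1600000 in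
/-- **(B-desc) TWO-CHART EDITION (shared cut-off, shared block function, ONE constant).**  House frame, admissible compact chart `S`, covered split-chart place `w₀ ∉ S`,
semiregular point `p` of the wall `(w₀, 0, 2)`, `a′ ∈ C_c^∞(G′_∞)`, the SHARED rank-one datum `(μ₀, μ₀′)` on `U(J)`, `U(J) ⧸ A_J` (linked through every inversion-invariant Haar
`ρ` of the split torus, cert. (v34b)): there are `K ≠ 0`, open `U ∋ p`, `U″ ∋ hcCayPt w₀ 0 2 p` (off the real wall `G`-regular for `S ∪ {w₀}`) and ONE JOINTLY SMOOTH family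
`f : (coordinates) × M₂(ℂ) → ℂ`, compactly supported in the matrix variable uniformly in `c` and depending on `c` only through `update c w₀ (0, c_{w₀1}, 0)`, with
**`chartOrbG L α ν′ S a′ c = K · ∫_{U(J)} f(c, ↑↑(h · P diag(e^{i c_{w₀0}}, e^{i c_{w₀2}}) P⁻¹ · h⁻¹)) dμ₀(h)`** for every `c ∈ U ∩ RegG S` and
**`chartOrbG L α ν′ (S ∪ {w₀}) a′ c″ = K · ∫_{U(J) ⧸ A_J} f(c″, ↑↑(y · hypBlockGL (c″_{w₀0}) (c″_{w₀2}) · y⁻¹)) dμ₀′(ẏ)`** for every `c″ ∈ U″` with `c″_{w₀0} ≠ 0`.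
[cite: Rogawski1990, §4.12 Lemma 4.12.1 p. 66; §8.2 pp. 119–124] [cite: HarishChandra1970, Part I §3 Lemma 22] [cite: Shelstad1979, §4 Lemma 4.3 (p. 25)] [cite: Folland1995, §2.6 (2.52)] -/
theorem exists_descent_twoChart_chartOrbG (hα : ∀ i, α i ≠ 0)
    (hreal : ∀ (w : {w : InfinitePlace L // IsComplex w}) (i : Fin 3), (w.1.embedding (α i)).im = 0)
    {J : Matrix (Fin 2) (Fin 2) ℂ} (hJ : J = (StdForm.antidiagonal 2).over ℂ)
    [MeasurableSpace ↥(unitaryGroupOfForm (starRingEnd ℂ) J)] [BorelSpace ↥(unitaryGroupOfForm (starRingEnd ℂ) J)]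
    [LocallyCompactSpace ↥(unitaryGroupOfForm (starRingEnd ℂ) J)] [SecondCountableTopology ↥(unitaryGroupOfForm (starRingEnd ℂ) J)]
    (μ₀ : Measure ↥(unitaryGroupOfForm (starRingEnd ℂ) J)) [μ₀.IsHaarMeasure] [μ₀.IsMulRightInvariant]
    [MeasurableSpace (↥(unitaryGroupOfForm (starRingEnd ℂ) J) ⧸ torusU (starRingEnd ℂ) J)] [BorelSpace (↥(unitaryGroupOfForm (starRingEnd ℂ) J) ⧸ torusU (starRingEnd ℂ) J)]
    (μ₀' : Measure (↥(unitaryGroupOfForm (starRingEnd ℂ) J) ⧸ torusU (starRingEnd ℂ) J))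
    [SMulInvariantMeasure ↥(unitaryGroupOfForm (starRingEnd ℂ) J) (↥(unitaryGroupOfForm (starRingEnd ℂ) J) ⧸ torusU (starRingEnd ℂ) J) μ₀'] [IsFiniteMeasureOnCompacts μ₀']
    (hlink : ∀ (ρ : Measure ↥(torusU (starRingEnd ℂ) J)) [ρ.IsHaarMeasure] [ρ.IsInvInvariant],
      μ₀' = ρ ((fun q : ℝ × ℝ =>
        (⟨⟨hypBlockGL q.1 q.2, hypBlockGL_mem_of_eq_over hJ q.1 q.2⟩, hypBlockGL_mem_torusU hJ q.1 q.2⟩ : ↥(torusU (starRingEnd ℂ) J))) ''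
          (Set.Icc (0 : ℝ) 1 ×ˢ Set.Icc (0 : ℝ) (2 * π))) •
        quotientMeasure (torusU (starRingEnd ℂ) J) ρ (LineRing.isClosed_torusU_two (starRingEnd ℂ) J) μ₀)
    {S : Finset {w : InfinitePlace L // IsComplex w}} {w₀ : {w : InfinitePlace L // IsComplex w}} {p : {w : InfinitePlace L // IsComplex w} → Fin 3 → ℝ}
    (hS : ∀ w, w ∈ S → w ∈ splitChartPlaces L α) (hw₀ : w₀ ∉ S) (hwsp : w₀ ∈ splitChartPlaces L α) (hp : HcSemireg S w₀ 0 2 p)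
    {a' : ↥(arch (↥(maximalRealSubfield L)) L (IsCMField.complexConj L) 3 (Matrix.diagonal α)) → ℂ} (ha' : ArchSmooth L 3 (Matrix.diagonal α) a') :
    ∃ (K : ℂ) (U U'' : Set ({w : InfinitePlace L // IsComplex w} → Fin 3 → ℝ)) (f : ({w : InfinitePlace L // IsComplex w} → Fin 3 → ℝ) × Matrix (Fin 2) (Fin 2) ℂ → ℂ),
      K ≠ 0 ∧ IsOpen U ∧ p ∈ U ∧ IsOpen U'' ∧ hcCayPt w₀ 0 2 p ∈ U'' ∧ (∀ c ∈ U'', c w₀ 0 ≠ 0 → c ∈ RegG (insert w₀ S)) ∧ ContDiff ℝ ∞ f ∧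
      (∃ C : Set (Matrix (Fin 2) (Fin 2) ℂ), IsCompact C ∧ ∀ c X, X ∉ C → f (c, X) = 0) ∧
      (∀ c X, f (c, X) = f (Function.update c w₀ ![0, c w₀ 1, 0], X)) ∧
      (∀ c ∈ U ∩ RegG S, chartOrbG L α ν' S a' c =
        K * ∫ h : ↥(unitaryGroupOfForm (starRingEnd ℂ) J),
          f (c, (((h * ⟨Matrix.GeneralLinearGroup.mkOfDetNeZero !![(1 : ℂ), 1; 1, -1] det_cayleyTwo_ne_zero *
                circleDiagonal 2 ![Circle.exp (c w₀ 0), Circle.exp (c w₀ 2)] *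
                (Matrix.GeneralLinearGroup.mkOfDetNeZero !![(1 : ℂ), 1; 1, -1] det_cayleyTwo_ne_zero)⁻¹,
              cayley_conj_circleDiagonal_mem_of_eq_over hJ _⟩ * h⁻¹ : ↥(unitaryGroupOfForm (starRingEnd ℂ) J)) : GL (Fin 2) ℂ) : Matrix (Fin 2) (Fin 2) ℂ)) ∂μ₀) ∧
      ∀ c ∈ U'', c w₀ 0 ≠ 0 → chartOrbG L α ν' (insert w₀ S) a' c =
        K * ∫ y, descConj ((⟨hypBlockGL (c w₀ 0) (c w₀ 2), hypBlockGL_mem_of_eq_over hJ (c w₀ 0) (c w₀ 2)⟩ : ↥(unitaryGroupOfForm (starRingEnd ℂ) J))) (torusU (starRingEnd ℂ) J)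
          (LineRing.forall_mem_torusU_comm (starRingEnd ℂ) J (hypBlockGL_mem_torusU hJ (c w₀ 0) (c w₀ 2)))
          (fun b : ↥(unitaryGroupOfForm (starRingEnd ℂ) J) => f (c, ((b : GL (Fin 2) ℂ) : Matrix (Fin 2) (Fin 2) ℂ))) y ∂μ₀' := by
  -- ### frame facts
  have ha'c : Continuous a' := ha'.continuous
  have ha's : HasCompactSupport a' := ha'.hasCompactSupport
  obtain ⟨hreal2, hsgn⟩ := blockWeights_of_mem_splitChartPlaces L α w₀ hwsp
  have hs02 : p w₀ 0 = p w₀ 2 := hp.1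
  have h02c : Circle.exp (p w₀ 0) = Circle.exp (p w₀ 2) := by rw [hs02]
  have h01 : Circle.exp (p w₀ 0) ≠ Circle.exp (p w₀ 1) := by
    intro h; have h2 := hp.2.1; rw [hcThird_zero_two] at h2; exact h2 h.symm
  have hreg : ∀ w, w ≠ w₀ → w ∉ S → Function.Injective fun i : Fin 3 => Circle.exp (p w i) := fun w hne hw => hp.2.2.1 w hw hne
  have hregS : ∀ w, w ∈ S → p w 0 ≠ 0 := hp.2.2.2
  -- ### (M-UNFOLD), Cayley-torus edition (★ p850682): `e : Z(γ_p) ≃ₜ* B × K` with clauses [4]–[10], [5β]–[7β]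
  refine (exists_continuousMulEquiv_centralizer_gprimeTorus_semireg_cayley_torus L α S w₀ hα hS hw₀ hwsp p hs02 h01 hreg hregS).elim fun K hK => hK.elim fun e he => ?_
  obtain ⟨hKc, hKsub, hKcomm, h4, h5, h6, hmapT, h8, h9, h10, h5β, h6β, h7β⟩ := he
  -- ### (B-STD) package: `φ`, `e′`, `Ψ` (★ `exists_std_package`)
  refine (exists_std_package L α w₀ hJ hreal2 hsgn e _ _ hmapT).elim fun φ hφ => hφ.elim fun e' hY => hY.elim fun Ψ hZ => ?_
  have hφ := hZ.1
  have hval := hZ.2.1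
  have he' := hZ.2.2.1
  have hmapT' := hZ.2.2.2.1
  have hmem := hZ.2.2.2.2.1
  have hΨ := hZ.2.2.2.2.2.2
  -- (B-STD) (iii) for this `φ`: boosts go to `hypBlockGL`
  have hφβ : ∀ (cw : Fin 3 → ℝ) (h : ↥(unitaryGroupOfForm (starRingEnd ℂ) ((Matrix.diagonal ![α (lineOf (formSign L α w₀) 0), α (lineOf (formSign L α w₀) 2)]).map w₀.1.embedding))),
      (((h : ↥(unitaryGroupOfForm (starRingEnd ℂ) ((Matrix.diagonal ![α (lineOf (formSign L α w₀) 0), α (lineOf (formSign L α w₀) 2)]).map w₀.1.embedding))) : GL (Fin 2) ℂ) : Matrix (Fin 2) (Fin 2) ℂ) =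
        (boostStd (formRe L α w₀ ∘ lineOf (formSign L α w₀)) cw).submatrix ![0, 2] ![0, 2] →
      φ h = ⟨hypBlockGL (cw 0) (cw 2), hypBlockGL_mem_of_eq_over hJ (cw 0) (cw 2)⟩ := fun cw h hh =>
    std_eq_hypBlockGL_of_coe_eq_boost w₀.1.embedding ![α (lineOf (formSign L α w₀) 0), α (lineOf (formSign L α w₀) 2)] hJ hsgn φ hval
      (formRe L α w₀ ∘ lineOf (formSign L α w₀)) rfl rfl cw h hh
  -- ### the TWO chart tori sit inside `Z(γ_p)`
  have hTβ : chartTorusG L α (insert w₀ S) ≤ Subgroup.centralizer ({gprimeTorus L α S p} : Set ↥(arch (↥(maximalRealSubfield L)) L (IsCMField.complexConj L) 3 (Matrix.diagonal α))) := by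
    have h := chartTorusG_le_centralizer L α (insert w₀ S) (Function.update p w₀ ![0, p w₀ 1, p w₀ 0])
    rwa [← gprimeTorus_of_wall L α hw₀ hwsp hs02] at h
  have hT : chartTorusG L α S ≤ Subgroup.centralizer ({gprimeTorus L α S p} : Set ↥(arch (↥(maximalRealSubfield L)) L (IsCMField.complexConj L) 3 (Matrix.diagonal α))) :=
    chartTorusG_le_centralizer L α S p
  -- ### instances on `Z(γ_p)`, its quotient, `K`, `U(J) ⧸ φ(A)`
  have hZc : IsClosed ((Subgroup.centralizer ({gprimeTorus L α S p} : Set ↥(arch (↥(maximalRealSubfield L)) L (IsCMField.complexConj L) 3 (Matrix.diagonal α)))) :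
      Set ↥(arch (↥(maximalRealSubfield L)) L (IsCMField.complexConj L) 3 (Matrix.diagonal α))) := isClosed_centralizer_singleton_of_t2 _
  haveI : LocallyCompactSpace ↥(Subgroup.centralizer ({gprimeTorus L α S p} : Set ↥(arch (↥(maximalRealSubfield L)) L (IsCMField.complexConj L) 3 (Matrix.diagonal α)))) := hZc.isClosedEmbedding_subtypeVal.locallyCompactSpace
  haveI : SecondCountableTopology ↥(Subgroup.centralizer ({gprimeTorus L α S p} : Set ↥(arch (↥(maximalRealSubfield L)) L (IsCMField.complexConj L) 3 (Matrix.diagonal α)))) := TopologicalSpace.Subtype.secondCountableTopology _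
  letI : MeasurableSpace (↥(Subgroup.centralizer ({gprimeTorus L α S p} : Set ↥(arch (↥(maximalRealSubfield L)) L (IsCMField.complexConj L) 3 (Matrix.diagonal α)))) ⧸ (chartTorusG L α S).subgroupOf (Subgroup.centralizer ({gprimeTorus L α S p} : Set ↥(arch (↥(maximalRealSubfield L)) L (IsCMField.complexConj L) 3 (Matrix.diagonal α))))) := borel _
  haveI : BorelSpace (↥(Subgroup.centralizer ({gprimeTorus L α S p} : Set ↥(arch (↥(maximalRealSubfield L)) L (IsCMField.complexConj L) 3 (Matrix.diagonal α)))) ⧸ (chartTorusG L α S).subgroupOf (Subgroup.centralizer ({gprimeTorus L α S p} : Set ↥(arch (↥(maximalRealSubfield L)) L (IsCMField.complexConj L) 3 (Matrix.diagonal α))))) := ⟨rfl⟩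
  letI : MeasurableSpace (↥(Subgroup.centralizer ({gprimeTorus L α S p} : Set ↥(arch (↥(maximalRealSubfield L)) L (IsCMField.complexConj L) 3 (Matrix.diagonal α)))) ⧸ (chartTorusG L α (insert w₀ S)).subgroupOf (Subgroup.centralizer ({gprimeTorus L α S p} : Set ↥(arch (↥(maximalRealSubfield L)) L (IsCMField.complexConj L) 3 (Matrix.diagonal α))))) := borel _
  haveI : BorelSpace (↥(Subgroup.centralizer ({gprimeTorus L α S p} : Set ↥(arch (↥(maximalRealSubfield L)) L (IsCMField.complexConj L) 3 (Matrix.diagonal α)))) ⧸ (chartTorusG L α (insert w₀ S)).subgroupOf (Subgroup.centralizer ({gprimeTorus L α S p} : Set ↥(arch (↥(maximalRealSubfield L)) L (IsCMField.complexConj L) 3 (Matrix.diagonal α))))) := ⟨rfl⟩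
  haveI : LocallyCompactSpace ↥K := hKc.isClosedEmbedding_subtypeVal.locallyCompactSpace
  haveI : SecondCountableTopology ↥K := TopologicalSpace.Subtype.secondCountableTopology _
  letI : MeasurableSpace ↥K := borel _
  haveI : BorelSpace ↥K := ⟨rfl⟩
  letI : MeasurableSpace (↥(unitaryGroupOfForm (starRingEnd ℂ) J) ⧸ Subgroup.map (φ : ↥(unitaryGroupOfForm (starRingEnd ℂ) ((Matrix.diagonal ![α (lineOf (formSign L α w₀) 0), α (lineOf (formSign L α w₀) 2)]).map w₀.1.embedding)) →* ↥(unitaryGroupOfForm (starRingEnd ℂ) J)) ((circleDiagonal 2).codRestrict (unitaryGroupOfForm (starRingEnd ℂ) ((Matrix.diagonal ![α (lineOf (formSign L α w₀) 0), α (lineOf (formSign L α w₀) 2)]).map w₀.1.embedding)) (circleDiagonal_mem_archLocal_diagonal L 2 ![α (lineOf (formSign L α w₀) 0), α (lineOf (formSign L α w₀) 2)] w₀)).range) := borel _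
  haveI : BorelSpace (↥(unitaryGroupOfForm (starRingEnd ℂ) J) ⧸ Subgroup.map (φ : ↥(unitaryGroupOfForm (starRingEnd ℂ) ((Matrix.diagonal ![α (lineOf (formSign L α w₀) 0), α (lineOf (formSign L α w₀) 2)]).map w₀.1.embedding)) →* ↥(unitaryGroupOfForm (starRingEnd ℂ) J)) ((circleDiagonal 2).codRestrict (unitaryGroupOfForm (starRingEnd ℂ) ((Matrix.diagonal ![α (lineOf (formSign L α w₀) 0), α (lineOf (formSign L α w₀) 2)]).map w₀.1.embedding)) (circleDiagonal_mem_archLocal_diagonal L 2 ![α (lineOf (formSign L α w₀) 0), α (lineOf (formSign L α w₀) 2)] w₀)).range) := ⟨rfl⟩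
  haveI : CompactSpace ↥(Subgroup.map (φ : ↥(unitaryGroupOfForm (starRingEnd ℂ) ((Matrix.diagonal ![α (lineOf (formSign L α w₀) 0), α (lineOf (formSign L α w₀) 2)]).map w₀.1.embedding)) →* ↥(unitaryGroupOfForm (starRingEnd ℂ) J)) ((circleDiagonal 2).codRestrict (unitaryGroupOfForm (starRingEnd ℂ) ((Matrix.diagonal ![α (lineOf (formSign L α w₀) 0), α (lineOf (formSign L α w₀) 2)]).map w₀.1.embedding)) (circleDiagonal_mem_archLocal_diagonal L 2 ![α (lineOf (formSign L α w₀) 0), α (lineOf (formSign L α w₀) 2)] w₀)).range) := isCompact_iff_compactSpace.mp (isCompact_map_circleDiagonal_range L α w₀ φ)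
  have hAcomm : ∀ a b : ↥(Subgroup.map (φ : ↥(unitaryGroupOfForm (starRingEnd ℂ) ((Matrix.diagonal ![α (lineOf (formSign L α w₀) 0), α (lineOf (formSign L α w₀) 2)]).map w₀.1.embedding)) →* ↥(unitaryGroupOfForm (starRingEnd ℂ) J)) ((circleDiagonal 2).codRestrict (unitaryGroupOfForm (starRingEnd ℂ) ((Matrix.diagonal ![α (lineOf (formSign L α w₀) 0), α (lineOf (formSign L α w₀) 2)]).map w₀.1.embedding)) (circleDiagonal_mem_archLocal_diagonal L 2 ![α (lineOf (formSign L α w₀) 0), α (lineOf (formSign L α w₀) 2)] w₀)).range), a * b = b * a := by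
    rintro ⟨_, ⟨x, ⟨u, rfl⟩, rfl⟩⟩ ⟨_, ⟨y, ⟨v, rfl⟩, rfl⟩⟩
    apply Subtype.ext
    show (φ : ↥(unitaryGroupOfForm (starRingEnd ℂ) ((Matrix.diagonal ![α (lineOf (formSign L α w₀) 0), α (lineOf (formSign L α w₀) 2)]).map w₀.1.embedding)) →* ↥(unitaryGroupOfForm (starRingEnd ℂ) J)) _ * (φ : ↥(unitaryGroupOfForm (starRingEnd ℂ) ((Matrix.diagonal ![α (lineOf (formSign L α w₀) 0), α (lineOf (formSign L α w₀) 2)]).map w₀.1.embedding)) →* ↥(unitaryGroupOfForm (starRingEnd ℂ) J)) _ =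
      (φ : ↥(unitaryGroupOfForm (starRingEnd ℂ) ((Matrix.diagonal ![α (lineOf (formSign L α w₀) 0), α (lineOf (formSign L α w₀) 2)]).map w₀.1.embedding)) →* ↥(unitaryGroupOfForm (starRingEnd ℂ) J)) _ * (φ : ↥(unitaryGroupOfForm (starRingEnd ℂ) ((Matrix.diagonal ![α (lineOf (formSign L α w₀) 0), α (lineOf (formSign L α w₀) 2)]).map w₀.1.embedding)) →* ↥(unitaryGroupOfForm (starRingEnd ℂ) J)) _
    rw [← map_mul, ← map_mul, ← map_mul, ← map_mul, mul_comm u v]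
  -- ### a right- and inversion-invariant Haar measure on `Z(γ_p)` (★ p850728)
  obtain ⟨νM, hνM1, hνM2, hνM3⟩ := exists_isHaarMeasure_isMulRightInvariant_isInvInvariant_centralizer_arch (↥(maximalRealSubfield L)) L (IsCMField.complexConj L) 3
    (Matrix.diagonal α) ({gprimeTorus L α S p} : Set ↥(arch (↥(maximalRealSubfield L)) L (IsCMField.complexConj L) 3 (Matrix.diagonal α))) K hKc hKcomm e' μ₀
  haveI := hνM1; haveI := hνM2; haveI := hνM3
  -- ### Haar data on the two chart tori inside `Z(γ_p)`
  haveI := isHaarMeasure_chartHaarG L α S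
  haveI := isInvInvariant_chartHaarG L α S
  haveI := isHaarMeasure_map_subgroupOfEquivOfLe_symm hT (chartHaarG L α S)
  haveI := isInvInvariant_map_subgroupOfEquivOfLe_symm hT (chartHaarG L α S)
  haveI := isHaarMeasure_chartHaarG L α (insert w₀ S)
  haveI := isInvInvariant_chartHaarG L α (insert w₀ S)
  haveI := isHaarMeasure_map_subgroupOfEquivOfLe_symm hTβ (chartHaarG L α (insert w₀ S))
  haveI := isInvInvariant_map_subgroupOfEquivOfLe_symm hTβ (chartHaarG L α (insert w₀ S))
  -- ### a box-positive inversion-invariant Haar measure `σ` on the split torus `A_J`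
  have hTUc : IsClosed ((torusU (starRingEnd ℂ) J : Subgroup ↥(unitaryGroupOfForm (starRingEnd ℂ) J)) : Set ↥(unitaryGroupOfForm (starRingEnd ℂ) J)) :=
    LineRing.isClosed_torusU_two _ _
  haveI : LocallyCompactSpace ↥(torusU (starRingEnd ℂ) J) := hTUc.isClosedEmbedding_subtypeVal.locallyCompactSpace
  haveI : SecondCountableTopology ↥(torusU (starRingEnd ℂ) J) := TopologicalSpace.Subtype.secondCountableTopology _
  obtain ⟨σ, hσ⟩ : ∃ σ : Measure ↥(torusU (starRingEnd ℂ) J), σ.IsHaarMeasure := ⟨Measure.haar, inferInstance⟩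
  haveI : σ.IsInvInvariant := isInvInvariant_of_comm _ hTUc (fun x hx y hy => LineRing.forall_mem_torusU_comm (starRingEnd ℂ) J hy x hx) σ
  have hσ0 := measure_boxStd_ne_zero hJ σ
  have hσt := (measure_boxStd_lt_top hJ σ).ne
  -- ### [5β] through `φ`: the `B`-component of a Cayley-chart point is `hypBlockGL (c_{w₀0}) (c_{w₀2})`
  have h5β' : ∀ c : {w : InfinitePlace L // IsComplex w} → Fin 3 → ℝ,
      (e' ⟨gprimeTorus L α (insert w₀ S) c, gprimeTorus_insert_mem_centralizer L α hw₀ hwsp hs02 c⟩).1 =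
        ⟨hypBlockGL (c w₀ 0) (c w₀ 2), hypBlockGL_mem_of_eq_over hJ (c w₀ 0) (c w₀ 2)⟩ := fun c => by
    rw [he']
    exact hφβ (c w₀) _ (h5β c)
  -- ### (b2) the Cayley torus bookkeeping `e′(T♯′) = A_J × ⊤`, `Ψβ` (★ p850743), and `hTA`
  obtain ⟨hTAβ, -, Ψβ, -, hΨβ⟩ := hTAβ_package_semireg_std L α S w₀ hw₀ hwsp p hs02 K e h5β h7β hJ hsgn φ hval e' he'
  have hTA : ∀ g : ↥(Subgroup.centralizer ({gprimeTorus L α S p} : Set ↥(arch (↥(maximalRealSubfield L)) L (IsCMField.complexConj L) 3 (Matrix.diagonal α)))), g ∈ (chartTorusG L α S).subgroupOf (Subgroup.centralizer ({gprimeTorus L α S p} : Set ↥(arch (↥(maximalRealSubfield L)) L (IsCMField.complexConj L) 3 (Matrix.diagonal α)))) ↔ (e' g).1 ∈ Subgroup.map (φ : ↥(unitaryGroupOfForm (starRingEnd ℂ) ((Matrix.diagonal ![α (lineOf (formSign L α w₀) 0), α (lineOf (formSign L α w₀) 2)]).map w₀.1.embedding)) →* ↥(unitaryGroupOfForm (starRingEnd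 ℂ) J)) ((circleDiagonal 2).codRestrict (unitaryGroupOfForm (starRingEnd ℂ) ((Matrix.diagonal ![α (lineOf (formSign L α w₀) 0), α (lineOf (formSign L α w₀) 2)]).map w₀.1.embedding)) (circleDiagonal_mem_archLocal_diagonal L 2 ![α (lineOf (formSign L α w₀) 0), α (lineOf (formSign L α w₀) 2)] w₀)).range :=
    fun g => mem_iff_fst_mem_of_map_eq_prod_top _ _ e' hmapT' g
  -- ### (G′-CANCEL): the two descent scalars `κ`, `κβ` against the SHARED `(μ₀, μ₀′)`, and `dt′(B′_S)·κ = dt′(B′_♯)·κβ` (★ p850673)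
  obtain ⟨κ, κβ, hκ, hκβ, hmap, hmapβ, hKK⟩ := exists_hmap_hmapβ_descentConst_eq_of_clauses L α S w₀ p hw₀ hwsp hs02 hT hTβ νM hJ μ₀ μ₀' hlink σ hσ0 hσt
    (Subgroup.map (φ : ↥(unitaryGroupOfForm (starRingEnd ℂ) ((Matrix.diagonal ![α (lineOf (formSign L α w₀) 0), α (lineOf (formSign L α w₀) 2)]).map w₀.1.embedding)) →* ↥(unitaryGroupOfForm (starRingEnd ℂ) J)) ((circleDiagonal 2).codRestrict (unitaryGroupOfForm (starRingEnd ℂ) ((Matrix.diagonal ![α (lineOf (formSign L α w₀) 0), α (lineOf (formSign L α w₀) 2)]).map w₀.1.embedding)) (circleDiagonal_mem_archLocal_diagonal L 2 ![α (lineOf (formSign L α w₀) 0), α (lineOf (formSign L α w₀) 2)] w₀)).range) hAcomm K hKc hKcomm e h4 h5 h6 h6β φ e' he' h5β' hTA hTAβ Ψ hΨ Ψβ hΨβ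
  -- ### Harish-Chandra's compactness on a box around `p` (§1) and ONE cut-off `β` (★ p850338)
  obtain ⟨CS, U, hCSc, hUo, hpU, hUreg, hUx, hCM⟩ := exists_isCompact_mul_centralizer_box_hcSemireg L α S w₀ p hα hreal hS hw₀ hp ha's.isCompact
  obtain ⟨U'', hU''o, hpU'', hreg'', CB, hCBc, hCMB, hintB⟩ := exists_realWallBox_binders L α S w₀ p ν' hα hS hw₀ hwsp hp ha'c ha's
  obtain ⟨β, hβc, hβs, hβ0, -, hβ1⟩ := exists_continuous_hasCompactSupport_integral_comp_mul_eq_one_pos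
    (Subgroup.centralizer ({gprimeTorus L α S p} : Set ↥(arch (↥(maximalRealSubfield L)) L (IsCMField.complexConj L) 3 (Matrix.diagonal α)))) hZc νM ((hCSc.union hCBc).insert 1)
  have hβ1S : ∀ x ∈ CS, ∀ k₀ : ↥(Subgroup.centralizer ({gprimeTorus L α S p} : Set ↥(arch (↥(maximalRealSubfield L)) L (IsCMField.complexConj L) 3 (Matrix.diagonal α)))), ∫ h : ↥(Subgroup.centralizer ({gprimeTorus L α S p} : Set ↥(arch (↥(maximalRealSubfield L)) L (IsCMField.complexConj L) 3 (Matrix.diagonal α)))), β (x * (k₀ : ↥(arch (↥(maximalRealSubfield L)) L (IsCMField.complexConj L) 3 (Matrix.diagonal α))) *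
      (h : ↥(arch (↥(maximalRealSubfield L)) L (IsCMField.complexConj L) 3 (Matrix.diagonal α)))) ∂νM = 1 :=
    fun x hx k₀ => hβ1 x (Set.mem_insert_of_mem _ (Set.mem_union_left _ hx)) k₀
  have hβ1B : ∀ x ∈ CB, ∀ k₀ : ↥(Subgroup.centralizer ({gprimeTorus L α S p} : Set ↥(arch (↥(maximalRealSubfield L)) L (IsCMField.complexConj L) 3 (Matrix.diagonal α)))), ∫ h : ↥(Subgroup.centralizer ({gprimeTorus L α S p} : Set ↥(arch (↥(maximalRealSubfield L)) L (IsCMField.complexConj L) 3 (Matrix.diagonal α)))), β (x * (k₀ : ↥(arch (↥(maximalRealSubfield L)) L (IsCMField.complexConj L) 3 (Matrix.diagonal α))) *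
      (h : ↥(arch (↥(maximalRealSubfield L)) L (IsCMField.complexConj L) 3 (Matrix.diagonal α)))) ∂νM = 1 :=
    fun x hx k₀ => hβ1 x (Set.mem_insert_of_mem _ (Set.mem_union_right _ hx)) k₀
  -- ### the descended function `(a′)_M^β` (continuous, compactly supported) and its SMOOTH ambient reading (★ aM-SMOOTH, ★ eM-SMOOTH, φ's frame matrix)
  have haMc : Continuous fun m : ↥(Subgroup.centralizer ({gprimeTorus L α S p} : Set ↥(arch (↥(maximalRealSubfield L)) L (IsCMField.complexConj L) 3 (Matrix.diagonal α)))) =>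
      ∫ x, β x • a' (x * (m : ↥(arch (↥(maximalRealSubfield L)) L (IsCMField.complexConj L) 3 (Matrix.diagonal α))) * x⁻¹) ∂ν' :=
    continuous_integral_conj_subtype ν' _ hβc hβs ha'c
  have haMs : HasCompactSupport fun m : ↥(Subgroup.centralizer ({gprimeTorus L α S p} : Set ↥(arch (↥(maximalRealSubfield L)) L (IsCMField.complexConj L) 3 (Matrix.diagonal α)))) =>
      ∫ x, β x • a' (x * (m : ↥(arch (↥(maximalRealSubfield L)) L (IsCMField.complexConj L) 3 (Matrix.diagonal α))) * x⁻¹) ∂ν' :=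
    hasCompactSupport_integral_conj ν' _ hZc hβs ha's
  obtain ⟨ΘM, hΘM, haM⟩ := exists_contDiff_descended_eq L 3 (Matrix.diagonal α) ν' ha' β hβc hβs
    (Subgroup.centralizer ({gprimeTorus L α S p} : Set ↥(arch (↥(maximalRealSubfield L)) L (IsCMField.complexConj L) 3 (Matrix.diagonal α))))
  obtain ⟨Λ, hΛ, hΛb⟩ := exists_contDiff_coe_symm_archPiEquivCM_mulSingle_relabel_endoEmb L α w₀ (lineOf (formSign L α w₀))
  have hΛb' : ∀ b : ↥(unitaryGroupOfForm (starRingEnd ℂ) ((Matrix.diagonal ![α (lineOf (formSign L α w₀) 0), α (lineOf (formSign L α w₀) 2)]).map w₀.1.embedding)),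
      ((((e.symm (b, 1) : ↥(Subgroup.centralizer ({gprimeTorus L α S p} : Set ↥(arch (↥(maximalRealSubfield L)) L (IsCMField.complexConj L) 3 (Matrix.diagonal α))))) :
          ↥(arch (↥(maximalRealSubfield L)) L (IsCMField.complexConj L) 3 (Matrix.diagonal α))) : GL (Fin 3) (mixedSpace L)) : Matrix (Fin 3) (Fin 3) (mixedSpace L)) =
        Λ ((b : GL (Fin 2) ℂ) : Matrix (Fin 2) (Fin 2) ℂ) := fun b => by
    rw [h8 b]; exact hΛb b
  obtain ⟨M₀, hM₀⟩ : ∃ M₀ : GL (Fin 2) ℂ, ∀ h : ↥(unitaryGroupOfForm (starRingEnd ℂ) ((Matrix.diagonal ![α (lineOf (formSign L α w₀) 0), α (lineOf (formSign L α w₀) 2)]).map w₀.1.embedding)),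
      ((φ h : ↥(unitaryGroupOfForm (starRingEnd ℂ) J)) : GL (Fin 2) ℂ) = M₀ * (h : GL (Fin 2) ℂ) * M₀⁻¹ :=
    ⟨_, fun h => by rw [hval h, _root_.mul_inv_rev]⟩
  have hφsymm : ∀ u : ↥(unitaryGroupOfForm (starRingEnd ℂ) J),
      (((φ.symm u : ↥(unitaryGroupOfForm (starRingEnd ℂ) ((Matrix.diagonal ![α (lineOf (formSign L α w₀) 0), α (lineOf (formSign L α w₀) 2)]).map w₀.1.embedding))) : GL (Fin 2) ℂ) : Matrix (Fin 2) (Fin 2) ℂ) =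
        ((M₀⁻¹ : GL (Fin 2) ℂ) : Matrix (Fin 2) (Fin 2) ℂ) * ((u : GL (Fin 2) ℂ) : Matrix (Fin 2) (Fin 2) ℂ) * ((M₀ : GL (Fin 2) ℂ) : Matrix (Fin 2) (Fin 2) ℂ) := fun u => by
    have h := hM₀ (φ.symm u)
    rw [ContinuousMulEquiv.apply_symm_apply] at h
    have h' : ((φ.symm u : ↥(unitaryGroupOfForm (starRingEnd ℂ) ((Matrix.diagonal ![α (lineOf (formSign L α w₀) 0), α (lineOf (formSign L α w₀) 2)]).map w₀.1.embedding))) : GL (Fin 2) ℂ) =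
        M₀⁻¹ * (u : GL (Fin 2) ℂ) * M₀ := by
      rw [h]; group
    rw [h', Units.val_mul, Units.val_mul]
  -- `e′⁻¹(u, r) = e⁻¹(φ⁻¹ u, 1) · r` for every `r ∈ K` (clause [10])
  have hsymm : ∀ (u : ↥(unitaryGroupOfForm (starRingEnd ℂ) J)) (r : ↥K),
      e'.symm (u, r) = e.symm (φ.symm u, 1) * (r : ↥(Subgroup.centralizer ({gprimeTorus L α S p} : Set ↥(arch (↥(maximalRealSubfield L)) L (IsCMField.complexConj L) 3 (Matrix.diagonal α))))) := fun u r => by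
    apply e'.injective
    rw [ContinuousMulEquiv.apply_symm_apply, map_mul, he', he', ContinuousMulEquiv.apply_symm_apply, ContinuousMulEquiv.apply_symm_apply, h10 _ r.2]
    ext <;> simp
  -- ONE ambient cut-off `χ ≡ 1` on the common compact matrix support of all the block test functions
  have hS₀ : IsCompact ((fun u : ↥(unitaryGroupOfForm (starRingEnd ℂ) J) => ((u : GL (Fin 2) ℂ) : Matrix (Fin 2) (Fin 2) ℂ)) '' (Prod.fst '' (e' '' tsupport
      (fun m : ↥(Subgroup.centralizer ({gprimeTorus L α S p} : Set ↥(arch (↥(maximalRealSubfield L)) L (IsCMField.complexConj L) 3 (Matrix.diagonal α)))) =>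
        ∫ x, β x • a' (x * (m : ↥(arch (↥(maximalRealSubfield L)) L (IsCMField.complexConj L) 3 (Matrix.diagonal α))) * x⁻¹) ∂ν')))) :=
    (((haMs.isCompact.image e'.continuous).image continuous_fst).image (Units.continuous_val.comp continuous_subtype_val))
  obtain ⟨χ, hχd, hχc, hχ1, -⟩ := Literature.Analysis.Calculus.exists_contDiff_hasCompactSupport_eq_one_of_isCompact hS₀
  -- the tangential spectator `c ↦ ↑↑γ_{update c w₀ (0, c_{w₀1}, 0)}` is smooth
  have hupd : ContDiff ℝ ∞ fun c : {w : InfinitePlace L // IsComplex w} → Fin 3 → ℝ => Function.update c w₀ (![0, c w₀ 1, 0] : Fin 3 → ℝ) := by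
    refine contDiff_pi.2 fun w => ?_
    rcases eq_or_ne w w₀ with rfl | hw
    · simp only [Function.update_self]
      refine contDiff_pi.2 fun i => ?_
      fin_cases i
      · exact contDiff_const
      · exact contDiff_apply_apply ℝ ℝ w 1
      · exact contDiff_const
    · simp only [Function.update_of_ne hw]
      exact contDiff_apply ℝ (Fin 3 → ℝ) w
  have hRρ : ContDiff ℝ ∞ fun c : {w : InfinitePlace L // IsComplex w} → Fin 3 → ℝ =>
      (((gprimeTorus L α S (Function.update c w₀ (![0, c w₀ 1, 0] : Fin 3 → ℝ)) : ↥(arch (↥(maximalRealSubfield L)) L (IsCMField.complexConj L) 3 (Matrix.diagonal α))) :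
        GL (Fin 3) (mixedSpace L)) : Matrix (Fin 3) (Fin 3) (mixedSpace L)) := (contDiff_coe_gprimeTorus L α S).comp hupd
  -- the family
  obtain ⟨f, hf⟩ : ∃ f : ({w : InfinitePlace L // IsComplex w} → Fin 3 → ℝ) × Matrix (Fin 2) (Fin 2) ℂ → ℂ, f = fun q =>
      (χ q.2 : ℂ) * ΘM (Λ (((M₀⁻¹ : GL (Fin 2) ℂ) : Matrix (Fin 2) (Fin 2) ℂ) * q.2 * ((M₀ : GL (Fin 2) ℂ) : Matrix (Fin 2) (Fin 2) ℂ)) *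
        (((gprimeTorus L α S (Function.update q.1 w₀ (![0, q.1 w₀ 1, 0] : Fin 3 → ℝ)) : ↥(arch (↥(maximalRealSubfield L)) L (IsCMField.complexConj L) 3 (Matrix.diagonal α))) :
          GL (Fin 3) (mixedSpace L)) : Matrix (Fin 3) (Fin 3) (mixedSpace L))) := ⟨_, rfl⟩
  have hfs : ContDiff ℝ ∞ f := by
    rw [hf]
    refine ((Complex.ofRealCLM.contDiff.comp ((hχd ⊤).comp contDiff_snd)).mul
      (hΘM.comp (((hΛ.comp ((contDiff_const.mul contDiff_snd).mul contDiff_const)).mul (hRρ.comp contDiff_fst)))))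
  -- `f (c, ↑↑u) = (a′)_M^β (e′⁻¹(u, r))` for every `c`, `u` and every `r ∈ K` sitting over `γ_{update c w₀ (0, c_{w₀1}, 0)}`
  have hfB : ∀ (c : {w : InfinitePlace L // IsComplex w} → Fin 3 → ℝ) (u : ↥(unitaryGroupOfForm (starRingEnd ℂ) J)) (r : ↥K),
      (((r : ↥(Subgroup.centralizer ({gprimeTorus L α S p} : Set ↥(arch (↥(maximalRealSubfield L)) L (IsCMField.complexConj L) 3 (Matrix.diagonal α))))) : ↥(arch (↥(maximalRealSubfield L)) L (IsCMField.complexConj L) 3 (Matrix.diagonal α))) : GL (Fin 3) (mixedSpace L)) = (gprimeTorus L α S (Function.update c w₀ (![0, c w₀ 1, 0] : Fin 3 → ℝ)) : GL (Fin 3) (mixedSpace L)) →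
      (fun m : ↥(Subgroup.centralizer ({gprimeTorus L α S p} : Set ↥(arch (↥(maximalRealSubfield L)) L (IsCMField.complexConj L) 3 (Matrix.diagonal α)))) =>
        ∫ x, β x • a' (x * (m : ↥(arch (↥(maximalRealSubfield L)) L (IsCMField.complexConj L) 3 (Matrix.diagonal α))) * x⁻¹) ∂ν')
        (e'.symm (u, r)) = f (c, ((u : GL (Fin 2) ℂ) : Matrix (Fin 2) (Fin 2) ℂ)) := by
    intro c u r hr
    have haM' := congrFun haM (e'.symm (u, r))
    beta_reduce at haM'
    beta_reduce
    -- the smooth reading of the value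
    have hread : ΘM ((((e'.symm (u, r) :
        ↥(Subgroup.centralizer ({gprimeTorus L α S p} : Set ↥(arch (↥(maximalRealSubfield L)) L (IsCMField.complexConj L) 3 (Matrix.diagonal α))))) :
          ↥(arch (↥(maximalRealSubfield L)) L (IsCMField.complexConj L) 3 (Matrix.diagonal α))) : GL (Fin 3) (mixedSpace L)) : Matrix (Fin 3) (Fin 3) (mixedSpace L)) =
        ΘM (Λ (((M₀⁻¹ : GL (Fin 2) ℂ) : Matrix (Fin 2) (Fin 2) ℂ) * ((u : GL (Fin 2) ℂ) : Matrix (Fin 2) (Fin 2) ℂ) * ((M₀ : GL (Fin 2) ℂ) : Matrix (Fin 2) (Fin 2) ℂ)) *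
          (((gprimeTorus L α S (Function.update c w₀ (![0, c w₀ 1, 0] : Fin 3 → ℝ)) : ↥(arch (↥(maximalRealSubfield L)) L (IsCMField.complexConj L) 3 (Matrix.diagonal α))) :
            GL (Fin 3) (mixedSpace L)) : Matrix (Fin 3) (Fin 3) (mixedSpace L))) := by
      rw [hsymm, Subgroup.coe_mul, Subgroup.coe_mul, Units.val_mul, hΛb' (φ.symm u), hφsymm u, hr]
    by_cases hu : (e'.symm (u, r)) ∈ tsupport
        (fun m : ↥(Subgroup.centralizer ({gprimeTorus L α S p} : Set ↥(arch (↥(maximalRealSubfield L)) L (IsCMField.complexConj L) 3 (Matrix.diagonal α)))) =>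
          ∫ x, β x • a' (x * (m : ↥(arch (↥(maximalRealSubfield L)) L (IsCMField.complexConj L) 3 (Matrix.diagonal α))) * x⁻¹) ∂ν')
    · have hχu : χ ((u : GL (Fin 2) ℂ) : Matrix (Fin 2) (Fin 2) ℂ) = 1 :=
        hχ1 _ ⟨u, ⟨(u, r), ⟨_, hu, e'.apply_symm_apply _⟩, rfl⟩, rfl⟩
      rw [hf]
      beta_reduce
      rw [hχu, Complex.ofReal_one, one_mul, haM', hread]
    · have h0 := image_eq_zero_of_notMem_tsupport hu
      beta_reduce at h0
      have h0' := h0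
      rw [haM', hread] at h0'
      rw [h0, hf]
      beta_reduce
      rw [h0', mul_zero]
  -- the `K`-components over the tangential point: [6] on the compact chart, [6β] on the Cayley chart
  have h6' : ∀ c : {w : InfinitePlace L // IsComplex w} → Fin 3 → ℝ,
      (((((e ⟨gprimeTorus L α S c, gprimeTorus_mem_centralizer L α S p c⟩).2 : ↥K) : ↥(Subgroup.centralizer ({gprimeTorus L α S p} : Set ↥(arch (↥(maximalRealSubfield L)) L (IsCMField.complexConj L) 3 (Matrix.diagonal α))))) : ↥(arch (↥(maximalRealSubfield L)) L (IsCMField.complexConj L) 3 (Matrix.diagonal α))) : GL (Fin 3) (mixedSpace L)) =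
        (gprimeTorus L α S (Function.update c w₀ (![0, c w₀ 1, 0] : Fin 3 → ℝ)) : GL (Fin 3) (mixedSpace L)) := fun c => by rw [h6 c]
  have h6β' : ∀ c : {w : InfinitePlace L // IsComplex w} → Fin 3 → ℝ,
      (((((e' ⟨gprimeTorus L α (insert w₀ S) c, hTβ (gprimeTorus_mem_chartTorusG L α (insert w₀ S) c)⟩).2 : ↥K) : ↥(Subgroup.centralizer ({gprimeTorus L α S p} : Set ↥(arch (↥(maximalRealSubfield L)) L (IsCMField.complexConj L) 3 (Matrix.diagonal α))))) : ↥(arch (↥(maximalRealSubfield L)) L (IsCMField.complexConj L) 3 (Matrix.diagonal α))) : GL (Fin 3) (mixedSpace L)) =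
        (gprimeTorus L α S (Function.update c w₀ (![0, c w₀ 1, 0] : Fin 3 → ℝ)) : GL (Fin 3) (mixedSpace L)) := fun c => by
    rw [he']
    exact congrArg _ (h6β c)
  -- ### the descent constant `K = dt′(B′)·κ ≠ 0`
  have hdtS := toReal_chartHaarG_chartBoxImgG_pos L α S hα hS
  have hK0 : (((chartHaarG L α S (chartBoxImgG L α S)).toReal : ℂ) * ((κ : ℝ) : ℂ)) ≠ 0 :=
    mul_ne_zero (Complex.ofReal_ne_zero.2 hdtS.ne') (Complex.ofReal_ne_zero.2 (NNReal.coe_ne_zero.2 hκ))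
  -- ### integrability at regular chart points (★ p850485)
  letI : MeasurableSpace (↥(arch (↥(maximalRealSubfield L)) L (IsCMField.complexConj L) 3 (Matrix.diagonal α)) ⧸ chartTorusG L α S) := borel _
  haveI : BorelSpace (↥(arch (↥(maximalRealSubfield L)) L (IsCMField.complexConj L) 3 (Matrix.diagonal α)) ⧸ chartTorusG L α S) := ⟨rfl⟩
  haveI := isMulLeftInvariant_chartHaarG L α S
  haveI := isFiniteMeasureOnCompacts_chartHaarG L α S
  haveI := isOpenPosMeasure_chartHaarG L α S
  have hq : chartQuotientMeasureG L α ν' S = quotientMeasure (chartTorusG L α S) (chartHaarG L α S) (isClosed_chartTorusG L α S) ν' := rfl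
  haveI : IsFiniteMeasureOnCompacts (chartQuotientMeasureG L α ν' S) := by rw [hq]; infer_instance
  -- ### the block reading of `γ_c` through `e′` ([5] + (B-STD) (i))
  have hγ : ∀ c : {w : InfinitePlace L // IsComplex w} → Fin 3 → ℝ,
      e' ⟨gprimeTorus L α S c, hT (gprimeTorus_mem_chartTorusG L α S c)⟩ =
        ((⟨Matrix.GeneralLinearGroup.mkOfDetNeZero !![(1 : ℂ), 1; 1, -1] det_cayleyTwo_ne_zero *
            circleDiagonal 2 ![Circle.exp (c w₀ 0), Circle.exp (c w₀ 2)] *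
            (Matrix.GeneralLinearGroup.mkOfDetNeZero !![(1 : ℂ), 1; 1, -1] det_cayleyTwo_ne_zero)⁻¹, cayley_conj_circleDiagonal_mem_of_eq_over hJ _⟩ : ↥(unitaryGroupOfForm (starRingEnd ℂ) J)),
          (e ⟨gprimeTorus L α S c, gprimeTorus_mem_centralizer L α S p c⟩).2) := by
    intro c
    have h1 : (e ⟨gprimeTorus L α S c, gprimeTorus_mem_centralizer L α S p c⟩).1 =
        ⟨circleDiagonal 2 ![Circle.exp (c w₀ 0), Circle.exp (c w₀ 2)],
          circleDiagonal_mem_unitaryGroupOfForm_diagonal_map_weights w₀.1.embedding ![α (lineOf (formSign L α w₀) 0), α (lineOf (formSign L α w₀) 2)] _⟩ :=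
      Subtype.ext (h5 c)
    rw [he', h1, hφ]
  -- ### the block reading of the Cayley-chart point `γ♯_c` through `e′` ([5β] + (B-STD) (iii))
  have hγβ : ∀ c : {w : InfinitePlace L // IsComplex w} → Fin 3 → ℝ,
      e' ⟨gprimeTorus L α (insert w₀ S) c, hTβ (gprimeTorus_mem_chartTorusG L α (insert w₀ S) c)⟩ =
        ((⟨hypBlockGL (c w₀ 0) (c w₀ 2), hypBlockGL_mem_of_eq_over hJ (c w₀ 0) (c w₀ 2)⟩ : ↥(unitaryGroupOfForm (starRingEnd ℂ) J)),
          (e' ⟨gprimeTorus L α (insert w₀ S) c, hTβ (gprimeTorus_mem_chartTorusG L α (insert w₀ S) c)⟩).2) := fun c =>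
    Prod.ext (h5β' c) rfl
  have hKK' : (((chartHaarG L α (insert w₀ S) (chartBoxImgG L α (insert w₀ S))).toReal : ℂ) * ((κβ : ℝ) : ℂ)) =
      ((chartHaarG L α S (chartBoxImgG L α S)).toReal : ℂ) * ((κ : ℝ) : ℂ) := by exact_mod_cast hKK.symm
  -- ### assembling
  refine ⟨(((chartHaarG L α S (chartBoxImgG L α S)).toReal : ℂ) * ((κ : ℝ) : ℂ)), U, U'', f, hK0, hUo, hpU, hU''o, hpU'', hreg'', hfs, ⟨tsupport χ, hχc, fun c X hX => ?_⟩,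
    fun c X => ?_, ?_, ?_⟩
  · rw [hf]; dsimp only; rw [image_eq_zero_of_notMem_tsupport hX, Complex.ofReal_zero, zero_mul]
  · rw [hf]; dsimp only; rw [Function.update_idem, Function.update_self]
    simp
  · rintro c ⟨hcU, hcreg⟩
    have hint := integrable_descConj_gprimeTorus_of_regG L α S hα hS hcreg ha'c ha's (chartQuotientMeasureG L α ν' S)
    rw [chartOrbG_eq_integral_descended_of_cutoff L α ν' S a' ha'c (gprimeTorus L α S p) νM hT hβc hβs hβ0 hβ1S c hint (hCM c hcU),
      integral_descConj_eq_smul_integral_of_block _ _ e' Ψ hΨ _ μ₀ hmap _ _ _ (hγ c) _ haMc, NNReal.smul_def, Complex.real_smul, ← mul_assoc]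
    congr 1
    refine integral_congr_ae (Filter.Eventually.of_forall fun b => ?_)
    exact hfB c _ _ (h6' c)
  · intro c hcU hx
    rw [chartOrbG_eq_integral_descended_of_cutoff L α ν' (insert w₀ S) a' ha'c (gprimeTorus L α S p) νM hTβ hβc hβs hβ0 hβ1B c (hintB c hcU hx) (hCMB c hcU),
      integral_descConj_eq_smul_integral_descConj_of_block _ (torusU (starRingEnd ℂ) J) e' Ψβ hΨβ _ μ₀' hmapβ _ _ _ (hγβ c) _
        (LineRing.forall_mem_torusU_comm (starRingEnd ℂ) J (hypBlockGL_mem_torusU hJ (c w₀ 0) (c w₀ 2))) _,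
      NNReal.smul_def, Complex.real_smul, ← mul_assoc, hKK']
    congr 1
    refine integral_congr_ae (Filter.Eventually.of_forall fun y => ?_)
    have hfun : (fun b : ↥(unitaryGroupOfForm (starRingEnd ℂ) J) =>
        (fun m : ↥(Subgroup.centralizer ({gprimeTorus L α S p} : Set ↥(arch (↥(maximalRealSubfield L)) L (IsCMField.complexConj L) 3 (Matrix.diagonal α)))) => ∫ x, β x • a' (x * (m : ↥(arch (↥(maximalRealSubfield L)) L (IsCMField.complexConj L) 3 (Matrix.diagonal α))) * x⁻¹) ∂ν')
          (e'.symm (b, (e' ⟨gprimeTorus L α (insert w₀ S) c, hTβ (gprimeTorus_mem_chartTorusG L α (insert w₀ S) c)⟩).2))) =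
        fun b : ↥(unitaryGroupOfForm (starRingEnd ℂ) J) => f (c, ((b : GL (Fin 2) ℂ) : Matrix (Fin 2) (Fin 2) ℂ)) :=
      funext fun b => hfB c b _ (h6β' c)
    rw [hfun]

end Chart

end Literature.NumberTheory.Rogawski1990

end
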